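import Summits.KontsevichZagierPeriods.KontsevichZagierPeriods.Theses.HurwitzMicroSectors
import Literature.NumberTheory.Transcendental.BoxCoordinatePowerMap

/-!
# `DilationMove` (stmt-KontsevichZagierPeriods-3872, route HurwitzMicroSectors) — line
`coordpow-api-assembly` (lead skeleton)

The crux: for `m ≥ 1` and representations `r, r'` of the Kontsevich–Zagier calculus on the open
unit box `(0,1)ⁿ` with `r.integrand x = r'.integrand (xᵢᵐ)ᵢ · mⁿ ∏ᵢ xᵢ^(m-1)` on the box,
`[r] − [r']` is ONE change-of-variables generator (`KZ.changeOfVariablesRel`, rule (2) of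
[Kontsevich–Zagier 2001, §1.2]) — the "dilation move" realising the Hurwitz distribution relations.

Line: the witness is `Φ = BoxIntegral.coordPow m` (`x ↦ (xᵢᵐ)ᵢ`) with derivative
`Φ' = BoxIntegral.coordPowDeriv m` from `Literature/NumberTheory/Transcendental/BoxCoordinatePowerMap.lean`,
which already proves differentiability, injectivity on the nonnegative orthant, `Φ '' (0,1)ⁿ = (0,1)ⁿ`
and `det Φ'(x) = mⁿ ∏ xᵢ^(m-1)`. Two stubs:

* `stub_isSemialgebraicMapOn_coordPow` — the polynomial map `(Xᵢ^m)ᵢ` is `ℚ`-semialgebraic on every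
  `ℚ`-semialgebraic set (`isSemialgebraicMapOn_aeval` + `IsSemialgebraicMapOn.congr`);
* `stub_orthantCoordPowMove` — the move on ANY domain inside the open orthant `{x | ∀ i, 0 < xᵢ}`
  with target domain `Φ '' r.domain` (positivity of the Jacobian needs only `xᵢ > 0`);

and the composition `DilationMove_of` specialises to the unit box via `image_coordPow_box`.
-/

noncomputable section

open Set MeasureTheory
open Literature.NumberTheory.Transcendental
open Literature.ModelTheory.ExponentialFields (IsSemialgebraic)

namespace Summit.KontsevichZagierPeriods.HurwitzMicroSectors.DilationMove

open Summit.KontsevichZagierPeriods.KontsevichZagierPeriods.Theses.HurwitzMicroSectors (DilationMove)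

/-- **Stub 1 (tameness).** The coordinatewise power map `x ↦ (xᵢᵐ)ᵢ` is a `ℚ`-semialgebraic map on
every `ℚ`-semialgebraic set `σ ⊆ ℝⁿ` (it is the polynomial map `(Xᵢ^m)ᵢ`). [BCR 1998, §2.2] -/
theorem stub_isSemialgebraicMapOn_coordPow :
    ∀ (n m : ℕ) (σ : Set (Fin n → ℝ)), IsSemialgebraic ℚ σ →
      IsSemialgebraicMapOn ℚ σ (fun x : Fin n → ℝ => BoxIntegral.coordPow m x) := by
  sorry

/-- **Stub 2 (the orthant move).** For `m ≥ 1`, a representation `r` whose domain lies in the open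
orthant, and `r'` with domain `Φₘ '' r.domain` and `r.integrand x = r'.integrand (Φₘ x) · mⁿ ∏ᵢ xᵢ^(m-1)`
on `r.domain`, the difference `[r] − [r']` is one change-of-variables generator (witness
`Φ' = BoxIntegral.coordPowDeriv m`, `|det| = det > 0` on the orthant). [Kontsevich–Zagier 2001, §1.2 (2)] -/
theorem stub_orthantCoordPowMove :
    ∀ (n m : ℕ), 1 ≤ m → ∀ (r r' : KZ.IntegralRep n), r.domain ⊆ {x | ∀ i, 0 < x i} →
      IsSemialgebraicMapOn ℚ r.domain (fun x : Fin n → ℝ => BoxIntegral.coordPow m x) →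
      r'.domain = (fun x : Fin n → ℝ => BoxIntegral.coordPow m x) '' r.domain →
      (∀ x ∈ r.domain, r.integrand x =
        r'.integrand (BoxIntegral.coordPow m x) * ((m : ℝ) ^ n * ∏ i, x i ^ (m - 1))) →
      KZ.of r - KZ.of r' ∈ KZ.changeOfVariablesRel := by
  sorry

/-- **Composition.** The two stubs give the crux `DilationMove`: on the open unit box the orthant
move applies (`0 < xᵢ`), and its target domain `Φₘ '' (0,1)ⁿ` is the unit box again
(`BoxIntegral.image_coordPow_box`, `m ≠ 0`). [Kontsevich–Zagier 2001, §1.2 (2)] -/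
theorem DilationMove_of : DilationMove := by
  intro n m hm r r' hr hr' hint
  have hm0 : m ≠ 0 := by omega
  have hsub : r.domain ⊆ {x | ∀ i, 0 < x i} := by
    rw [hr]
    exact fun x hx i => (hx i).1
  refine stub_orthantCoordPowMove n m hm r r' hsub
    (stub_isSemialgebraicMapOn_coordPow n m r.domain r.isSemialgebraic_domain) ?_ ?_
  · rw [hr', hr]
    exact (BoxIntegral.image_coordPow_box hm0).symm
  · intro x hx
    exact hint x hx

end Summit.KontsevichZagierPeriods.HurwitzMicroSectors.DilationMove
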